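import Summits.RiemannHypothesis.RiemannHypothesis.Theorems.RuelleBandExactFirstBandStubEvenTransfer
import Summits.RiemannHypothesis.RiemannHypothesis.Theorems.RuelleBandCofiniteCriticalLineStubCofiniteWeilCriterion
import Summits.RiemannHypothesis.RiemannHypothesis.Theorems.WeilGroundStateGroundStatesConvergeToXiZeroSideOffLine
import Literature.NumberTheory.LFunctions.ZetaZeros
import HarnessLib

/-!
# Crux `OffLineParityDetection` (stmt-RiemannHypothesis-15431), line `registered`: stub EVEN-LOW

Route `WeilParity`, crux
`Summit.RiemannHypothesis.RiemannHypothesis.Theses.WeilParity.OffLineParityDetection`, line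
`registered`.  This file proves the registered stub `stub_evenOffLineLowerBound` BY NAME, with the
registered signature: for a REAL-valued EVEN Weil test `e` and the (assumed finite) set `S` of
off-line zeros of `ζ` in the open critical strip, `Σ_{ρ ∈ S} m(ρ) Re ê(ρ)² ≤ Re Q(e)`.

## Proof

For a test function `h` the quadratic functional is the zero-side form,
`Q(h) = W(h ⋆ h̃) = Q₀(h) = Σ_ρ m(ρ) P_h(ρ)` over the non-trivial zeros, with
`P_h(ρ) = ĥ(ρ) conj ĥ(1 - ρ̄)` (`WeilConverse.zeroForm`, `WeilConverse.pairCoeff`): both sides are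
the limit of the symmetric partial zero sums of `h ⋆ h̃` (`WeilConverse.hasWeilZeroSide_zeroForm`
and the PROVED explicit formula `explicit_formula_holds`; tree lemma
`RuelleBandCofiniteCriticalLine.stub_cofiniteWeilCriterion_zeroForm_eq`).  The series converges
absolutely (`WeilConverse.summable_pairCoeff`), so `Re Q(e) = Σ_ρ Re (m(ρ) P_e(ρ))`
(`Complex.re_tsum`).  For an even real `e`, `P_e(ρ) = ê(ρ)²` (`stub_evenTransfer_pairCoeff`), so
the terms at `ρ ∈ S` (a finite subset of the non-trivial zeros) are `m(ρ) Re ê(ρ)²`; every other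
non-trivial zero `ρ` lies ON the critical line (it is a zero in the open strip not in `S`), where
`1 - ρ̄ = ρ` and `P_e(ρ) = ê(ρ) conj ê(ρ) = |ê(ρ)|² ≥ 0` with `m(ρ) ≥ 0` (tree lemma
`GroundStatesConvergeToXi.re_order_mul_pairCoeff_nonneg_of_re_eq_half`).  Dropping the non-negative
terms off `S` only decreases the sum (`Summable.sum_le_tsum`).

References: E. Bombieri, *Remarks on Weil's quadratic functional in the theory of prime numbers I*,
Rend. Lincei (9) 11 (2000), 183–233, §3 Thm. 1 (zero-side form of the explicit formula); A. Weil,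
*Sur les "formules explicites" de la théorie des nombres premiers* (1952).
-/

-- the problem directory `RiemannHypothesis/RiemannHypothesis` fixes the namespace (gate convention)
set_option linter.dupNamespace false

noncomputable section

namespace Summit.RiemannHypothesis.RiemannHypothesis.Theorems.WeilParityOffLineParityDetection

open MeasureTheory Set
open scoped ComplexConjugate
open Literature.NumberTheory.LFunctions
open Summit.RiemannHypothesis.RiemannHypothesis.Theorems.RuelleBandExactFirstBand
open Summit.RiemannHypothesis.RiemannHypothesis.Theorems.RuelleBandCofiniteCriticalLine
  (stub_cofiniteWeilCriterion_zeroForm_eq)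
open Summit.RiemannHypothesis.RiemannHypothesis.Theorems.GroundStatesConvergeToXi
  (re_order_mul_pairCoeff_nonneg_of_re_eq_half)

/-- For an even real-valued `g` the zero-side term at `ρ` has real part `m(ρ) Re ĝ(ρ)²`
(`P_g(ρ) = ĝ(ρ)²`, `stub_evenTransfer_pairCoeff`). [folklore] -/
theorem stub_evenOffLineLowerBound_term_re_of_even {g : ℝ → ℂ} (heven : ∀ t : ℝ, g (-t) = g t)
    (hreal : ∀ t : ℝ, (g t).im = 0) (ρ : ℂ) :
    ((riemannZetaZeroOrder ρ : ℂ) * WeilConverse.pairCoeff g ρ).re =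
      (riemannZetaZeroOrder ρ : ℝ) * ((weilMellin g ρ) ^ 2).re := by
  rw [stub_evenTransfer_pairCoeff heven hreal, ← pow_two, ← Complex.ofReal_intCast,
    Complex.re_ofReal_mul]

/-- The real part of Weil's quadratic functional of a test function as an absolutely convergent
real series over the non-trivial zeros: `Re Q(g) = Σ_ρ Re (m(ρ) P_g(ρ))`
(`stub_cofiniteWeilCriterion_zeroForm_eq`, `Complex.re_tsum`, `WeilConverse.summable_pairCoeff`).
[cite: Bombieri2000Weil, §3 Thm. 1] -/
theorem stub_evenOffLineLowerBound_re_weilQuadratic {g : ℝ → ℂ} (hg : IsWeilTest g) :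
    (weilQuadratic g).re = ∑' ρ : ZetaZeros.riemannZetaNontrivialZeros,
      ((riemannZetaZeroOrder (ρ : ℂ) : ℂ) * WeilConverse.pairCoeff g ρ).re := by
  rw [← stub_cofiniteWeilCriterion_zeroForm_eq hg, WeilConverse.zeroForm,
    Complex.re_tsum (WeilConverse.summable_pairCoeff hg)]

/-- The real parts of the zero-side terms of a test function are summable. [folklore] -/
theorem stub_evenOffLineLowerBound_summable_re {g : ℝ → ℂ} (hg : IsWeilTest g) :
    Summable fun ρ : ZetaZeros.riemannZetaNontrivialZeros ↦
      ((riemannZetaZeroOrder (ρ : ℂ) : ℂ) * WeilConverse.pairCoeff g ρ).re :=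
  (Complex.hasSum_re (WeilConverse.summable_pairCoeff hg).hasSum).summable

/-- **Stub EVEN-LOW of crux `OffLineParityDetection` (registered signature).**  For a REAL-valued
EVEN Weil test `e` and the finite set `S` of off-line zeros of `ζ` in the open critical strip, the
off-line part of the zero side bounds `Re Q(e)` from below: `Σ_{ρ ∈ S} m(ρ) Re ê(ρ)² ≤ Re Q(e)`.
Indeed `Re Q(e) = Σ_ρ Re (m(ρ) P_e(ρ))` over the non-trivial zeros (absolutely convergent,
`stub_evenOffLineLowerBound_re_weilQuadratic`), the terms at `ρ ∈ S` are `m(ρ) Re ê(ρ)²`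
(`stub_evenOffLineLowerBound_term_re_of_even`), and every non-trivial zero outside `S` lies on the
critical line, where its term is `m(ρ) |ê(ρ)|² ≥ 0` (`re_order_mul_pairCoeff_nonneg_of_re_eq_half`);
drop them (`Summable.sum_le_tsum`).
[cite: Bombieri2000Weil, §3 Thm. 1 (zero-side form); Weil1952] -/
theorem stub_evenOffLineLowerBound :
    ∀ e : ℝ → ℂ, IsWeilTest e → (∀ t, e (-t) = e t) → (∀ t, (e t).im = 0) →
      ∀ hS : ({ρ : ℂ | riemannZeta ρ = 0 ∧ 0 < ρ.re ∧ ρ.re < 1 ∧ ρ.re ≠ 1 / 2}).Finite,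
        ∑ ρ ∈ hS.toFinset, (riemannZetaZeroOrder ρ : ℝ) * ((weilMellin e ρ) ^ 2).re ≤
          (weilQuadratic e).re := by
  intro e he hev hreal hS
  classical
  -- `S` sits inside the non-trivial zeros
  have hmem : ∀ ρ ∈ hS.toFinset, ρ ∈ ZetaZeros.riemannZetaNontrivialZeros := fun ρ hρ ↦ by
    obtain ⟨hζ, h0, h1, -⟩ := hS.mem_toFinset.1 hρ
    exact ZetaZeros.riemannZetaNontrivialZeros.mem_iff'.2 ⟨hζ, h0, h1⟩
  -- the finite sum, reindexed by the corresponding finset of the subtype of non-trivial zeros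
  have hLHS : ∑ ρ ∈ hS.toFinset, (riemannZetaZeroOrder ρ : ℝ) * ((weilMellin e ρ) ^ 2).re =
      ∑ ρ ∈ hS.toFinset.subtype (· ∈ ZetaZeros.riemannZetaNontrivialZeros),
        ((riemannZetaZeroOrder (ρ : ℂ) : ℂ) * WeilConverse.pairCoeff e ρ).re := by
    rw [Finset.sum_subtype_of_mem
      (fun ρ : ℂ ↦ ((riemannZetaZeroOrder ρ : ℂ) * WeilConverse.pairCoeff e ρ).re) hmem]
    exact Finset.sum_congr rfl fun ρ _ ↦
      (stub_evenOffLineLowerBound_term_re_of_even hev hreal ρ).symm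
  -- drop the (non-negative) on-line terms
  calc ∑ ρ ∈ hS.toFinset, (riemannZetaZeroOrder ρ : ℝ) * ((weilMellin e ρ) ^ 2).re
      = ∑ ρ ∈ hS.toFinset.subtype (· ∈ ZetaZeros.riemannZetaNontrivialZeros),
          ((riemannZetaZeroOrder (ρ : ℂ) : ℂ) * WeilConverse.pairCoeff e ρ).re := hLHS
    _ ≤ ∑' ρ : ZetaZeros.riemannZetaNontrivialZeros,
          ((riemannZetaZeroOrder (ρ : ℂ) : ℂ) * WeilConverse.pairCoeff e ρ).re := by
        refine (stub_evenOffLineLowerBound_summable_re he).sum_le_tsum _ fun ρ hρ ↦ ?_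
        -- a non-trivial zero outside `S` is on the critical line
        have hre : (ρ : ℂ).re = 1 / 2 := by
          by_contra hne
          exact hρ (Finset.mem_subtype.2 (hS.mem_toFinset.2
            ⟨ZetaZeros.riemannZetaNontrivialZeros.zeta_eq_zero ρ.2,
              ZetaZeros.riemannZetaNontrivialZeros.re_pos ρ.2,
              ZetaZeros.riemannZetaNontrivialZeros.re_lt_one ρ.2, hne⟩))
        exact re_order_mul_pairCoeff_nonneg_of_re_eq_half e ρ.2 hre
    _ = (weilQuadratic e).re := (stub_evenOffLineLowerBound_re_weilQuadratic he).symm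

end Summit.RiemannHypothesis.RiemannHypothesis.Theorems.WeilParityOffLineParityDetection

end
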